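import Literature.AlgebraicGeometry.Frobenioids.ArchimedeanPerfectionRationalFunctionMonoid
import HarnessLib

/-!
# Frobenioids II, Thm. 3.6 (i) at `Λ = ℚ`: the identification `(Φ^fld)^pf(d) ≃ O^×(X^birat)` GENERIC in the
# unit coordinate, and the NATURAL unit coordinate `(O_K^×)^pf ≃ O^×(X)` (FILE B-arch, part 2a′)

Mochizuki, *The geometry of Frobenioids II: poly-Frobenioids*, Kyushu J. Math. **62** (2008) 401–460, §3,
Theorem 3.6 (i), kurims text p. 36 ll. 34–35: "`(C^Λ)^istr` is of … model type, with rational function monoid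
naturally isomorphic to `(Φ^fld)^Λ`" [cite: MochizukiFrdII2008, Thm 3.6 (i) p.36]; Thm. 3.6 (v) p. 37
(`O^×(A) ≅ S¹ ⊗ ℚ`) [cite: MochizukiFrdII2008, Thm 3.6 (v) p.37]; [FrdI] Prop. 4.4 (ii)/(iii) p. 83
[cite: MochizukiFrdI2008, Prop. 4.4 (iii) p.83].

abc-iut cell, layer L1, row M13-c3 «FILE B-arch» (seat abc-iut-L1-t6), part 2a′.  Part 2a
(`ArchimedeanPerfectionRationalFunctionMonoid.lean`) built `isoOfSection X σ hσ` with the unit coordinate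
`unitsPerfEquiv X : (O_K^×)^pf ≃* O^×(X)`, `[w]^{1/c} ↦` the unit of value `w ⊗ 1/c`.  That coordinate is a
correct isomorphism but NOT natural in `X = (A, n)` (finding F-w5d246-1 of seat abc-iut-w5-d246, confirmed):
along a linear arrow `ψ = [ψ₀ : A^{(a)} → A′^{(b)}]`, `n·a = n′·b`, a rotation `z` of `A^{(a)}` is carried to the
rotation `z′` of `A′^{(b)}` with `z = (Base ψ₀).act z′` (abc-iut-w5-d246, `intertwines_rotUnit`), so the value
`unitVal` (normalised by the LEVEL `1/c` only, `Thm36Sub.levelVal`) is multiplied by `b/a = n/n′ = X.idx/X′.idx`,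
and the scalar is read through the structure isomorphisms `X.obj.iso`, `X′.obj.iso` (Galois twists).  The
natural coordinate is therefore
  `unitsPerfEquivNat X : [w]^{1/c} ↦ (unitsPerfEquiv X [ι_X^* w]^{1/c}) ^ X.idx`,
`ι_X^* =` the Galois twist of `X.obj.iso` (`D0.unitTwist (strTwist X)`), of value `X.idx • (ι_X^* w ⊗ 1/c)`.
This file:
* `D0.unitTwist σ K : O_K^× →* O_K^×` (the Galois action of a Boolean twist on norm-one scalars), `strTwist X`,
  `perfTwist X`, `unitsPerfEquivNat X` with its value `unitVal_unitsPerfEquivNat_mk/_of`;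
* `isoOfSectionE X e σ hσ` — part 2a's chain with an ARBITRARY unit coordinate
  `e : (O_K^×)^pf ≃* O^×(X)` in place of `unitsPerfEquiv X` (so `isoOfSection = isoOfSectionE _ (unitsPerfEquiv X)`
  up to unfolding, and the natural identification is `isoOfSectionE X (unitsPerfEquivNat X)`), with
  `isoOfSectionE_of/_apply`, `divHom_isoOfSectionE(_eq_divPerfection)` (the `div_iso` law — units have trivial
  divisor, so it holds for every `e`), and `intertwines_isoOfSectionE` (the `natural` law reduced to the radial
  generators `hrad` and the unit generators `hunit`, the latter now stated for `e`).
Data `def`s, no `def … : Prop`, no instances; [FrdII] §3 is classical; nothing here bears on [IUTchIII] Cor. 3.12.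
-/

noncomputable section

namespace Literature.AlgebraicGeometry.Frobenioids

open CategoryTheory Opposite
open scoped TensorProduct

namespace ArchFrd

/-! ### The Galois twist on norm-one scalars -/

namespace D0

/-- The action of a Boolean Galois twist (`false` = identity, `true` = complex conjugation) on `O_K^×`
(norm-one scalars are stable under `Gal(ℂ/ℝ)`). [cite: MochizukiFrdII2008, Def 3.1 (ii) p.23] -/
def unitTwist (σ : Bool) (K : D0) : unitScalars K →* unitScalars K where
  toFun u := ⟨galAct σ (u : ℂˣ), ⟨galAct_mem_scalars σ u.2.1, by rw [norm_galAct]; exact u.2.2⟩⟩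
  map_one' := Subtype.ext (map_one _)
  map_mul' a b := Subtype.ext (map_mul _ _ _)

/-- Underlying scalar of a twisted unit. [cite: MochizukiFrdII2008, Def 3.1 (ii) p.23] -/
@[simp] theorem coe_unitTwist (σ : Bool) (K : D0) (u : unitScalars K) :
    ((unitTwist σ K u : unitScalars K) : ℂˣ) = galAct σ (u : ℂˣ) := rfl

/-- The twist is an involution. [cite: MochizukiFrdII2008, Def 3.1 (i) p.23] -/
theorem unitTwist_unitTwist (σ : Bool) (K : D0) (u : unitScalars K) : unitTwist σ K (unitTwist σ K u) = u :=
  Subtype.ext (galAct_galAct σ _)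

/-- The trivial twist acts identically. [cite: MochizukiFrdII2008, Def 3.1 (i) p.23] -/
@[simp] theorem unitTwist_false (K : D0) (u : unitScalars K) : unitTwist false K u = u :=
  Subtype.ext (galAct_false _)

end D0

namespace Thm36Sub

universe v u

variable {D : Type u} [Category.{v} D] {π : D ⥤ D0}
variable {hF : PreFrobenioid.IsFrobenioid (C.toElem π)}

open PreFrobenioid PreFrobenioid.Perfection

/-! ### The natural unit coordinate `(O_K^×)^pf ≃ O^×(X)` -/

/-- The Galois twist of the structure isomorphism `Base(A₀) ≅ π(A_D)` of `X = ((A₀, A_D, ι), n)`: scalars of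
automorphisms are read on the `C₀`-side base, elements of `O_K^×`, `K = π(A_D)`, on the `D`-side.
[cite: MochizukiFrdII2008, Def 3.1 (iv) p.24] -/
def strTwist (X : pfCat π hF) : Bool := D0.Hom.twists X.obj.iso.hom

variable (X : pfCat π hF)

/-- The structure twist on `(O_K^×)^pf`. [cite: MochizukiFrdII2008, Thm 3.6 (v) p.37] -/
def perfTwist : Perfection (D0.unitScalars (π.obj X.obj.snd)) →* Perfection (D0.unitScalars (π.obj X.obj.snd)) :=
  Perfection.map (D0.unitTwist (strTwist X) (π.obj X.obj.snd))

/-- `perfTwist` on classes. [cite: MochizukiFrdII2008, Thm 3.6 (v) p.37] -/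
theorem perfTwist_mk (w : D0.unitScalars (π.obj X.obj.snd)) (c : ℕ+) :
    perfTwist X (Perfection.mk w c) = Perfection.mk (D0.unitTwist (strTwist X) _ w) c := rfl

/-- `perfTwist` is an involution. [cite: MochizukiFrdII2008, Thm 3.6 (v) p.37] -/
theorem perfTwist_perfTwist (p : Perfection (D0.unitScalars (π.obj X.obj.snd))) : perfTwist X (perfTwist X p) = p := by
  obtain ⟨⟨w, c⟩, rfl⟩ := Perfection.mk_surjective p
  show perfTwist X (perfTwist X (Perfection.mk w c)) = Perfection.mk w c
  rw [perfTwist_mk, perfTwist_mk, D0.unitTwist_unitTwist]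

/-- `perfTwist` is bijective. [cite: MochizukiFrdII2008, Thm 3.6 (v) p.37] -/
theorem perfTwist_bijective : Function.Bijective (perfTwist X) :=
  Function.Involutive.bijective (perfTwist_perfTwist X)

/-- The natural unit coordinate as a homomorphism: `p ↦ (unitsPerfEquiv X (ι_X^* p)) ^ X.idx`.
[cite: MochizukiFrdII2008, Thm 3.6 (v) p.37] -/
def unitsPerfNatHom : Perfection (D0.unitScalars (π.obj X.obj.snd)) →* unitsSubgroup (pfStr π hF) X :=
  (unitsPerfEquiv X).toMonoidHom.comp ((powMonoidHom (X.idx : ℕ)).comp (perfTwist X))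

/-- Unfolding `unitsPerfNatHom`. [cite: MochizukiFrdII2008, Thm 3.6 (v) p.37] -/
theorem unitsPerfNatHom_apply (p : Perfection (D0.unitScalars (π.obj X.obj.snd))) :
    unitsPerfNatHom X p = unitsPerfEquiv X (perfTwist X p ^ (X.idx : ℕ)) := rfl

/-- `unitsPerfNatHom` is bijective (`(O_K^×)^pf` is perfect, the twist is an involution).
[cite: MochizukiFrdII2008, Thm 3.6 (v) p.37] -/
theorem unitsPerfNatHom_bijective : Function.Bijective (unitsPerfNatHom X) :=
  (unitsPerfEquiv X).bijective.comp
    ((isPerfect_perfection.bijective_pow (X.idx : ℕ) X.idx.pos).comp (perfTwist_bijective X))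

/-- **The NATURAL unit coordinate `(O_K^×)^pf ≃* O^×(X)`** of `X = (A, n)`: `[w]^{1/c} ↦` the unit of value
`n • (ι_X^* w ⊗ 1/c)` (structure twist and index built in; see the module docstring for why).
[cite: MochizukiFrdII2008, Thm 3.6 (v) p.37] -/
def unitsPerfEquivNat : Perfection (D0.unitScalars (π.obj X.obj.snd)) ≃* unitsSubgroup (pfStr π hF) X :=
  MulEquiv.ofBijective (unitsPerfNatHom X) (unitsPerfNatHom_bijective X)

/-- Unfolding `unitsPerfEquivNat`. [cite: MochizukiFrdII2008, Thm 3.6 (v) p.37] -/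
theorem unitsPerfEquivNat_apply (p : Perfection (D0.unitScalars (π.obj X.obj.snd))) :
    unitsPerfEquivNat X p = unitsPerfEquiv X (perfTwist X p ^ (X.idx : ℕ)) := rfl

/-- `unitsPerfEquivNat` on classes. [cite: MochizukiFrdII2008, Thm 3.6 (v) p.37] -/
theorem unitsPerfEquivNat_mk (w : D0.unitScalars (π.obj X.obj.snd)) (c : ℕ+) :
    unitsPerfEquivNat X (Perfection.mk w c) =
      unitsPerfEquiv X (Perfection.mk (D0.unitTwist (strTwist X) _ w ^ (X.idx : ℕ)) c) := by
  rw [unitsPerfEquivNat_apply, perfTwist_mk, Perfection.mk_pow]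

/-- **The value of the natural coordinate**: `unitVal (unitsPerfEquivNat X [w]^{1/c}) = n • (ι_X^* w ⊗ 1/c)`.
[cite: MochizukiFrdII2008, Thm 3.6 (v) p.37] -/
theorem unitVal_unitsPerfEquivNat_mk (w : D0.unitScalars (π.obj X.obj.snd)) (c : ℕ+) :
    unitVal X (unitsPerfEquivNat X (Perfection.mk w c)) =
      (X.idx : ℕ) • (Additive.ofMul (unitCirc (D0.galAct (strTwist X) (w : ℂˣ))) ⊗ₜ[ℤ] ((c : ℚ)⁻¹)) := by
  rw [unitsPerfEquivNat_mk, unitVal_unitsPerfEquiv_mk, Subgroup.coe_pow,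
    unitCirc_pow (D0.unitTwist (strTwist X) _ w).2.2, ofMul_pow, TensorProduct.smul_tmul']
  rfl

/-- The value on `O_K^× ⊆ (O_K^×)^pf`: `unitVal (unitsPerfEquivNat X [w]) = ι_X^* w ⊗ n`.
[cite: MochizukiFrdII2008, Thm 3.6 (v) p.37] -/
theorem unitVal_unitsPerfEquivNat_of (w : D0.unitScalars (π.obj X.obj.snd)) :
    unitVal X (unitsPerfEquivNat X (Perfection.of _ w)) =
      Additive.ofMul (unitCirc (D0.galAct (strTwist X) (w : ℂˣ))) ⊗ₜ[ℤ] ((X.idx : ℕ) : ℚ) := by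
  rw [Perfection.of_apply, unitVal_unitsPerfEquivNat_mk, PNat.one_coe, Nat.cast_one, inv_one,
    ← TensorProduct.tmul_smul, Nat.smul_one_eq_cast]

/-! ### The identification `(Φ^gp(d) × O_K^×)^pf ≃ O^×(X^birat)`, generic in the unit coordinate -/

variable (e : Perfection (D0.unitScalars (π.obj X.obj.snd)) ≃* unitsSubgroup (pfStr π hF) X)

/-- **`(Φ^fld)^pf(d) ≃* O^×(X^birat)` from a unit coordinate `e` and a radial section `σ`**: part 2a's chain
`(Φ^gp × O_K^×)^pf ≃ (Φ^gp)^pf × (O_K^×)^pf ≃ (Φ^pf)^gp × O^×(X) ≃ O^×(X^birat)` with `e` in the unit slot.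
[cite: MochizukiFrdII2008, Thm 3.6 (i) p.36] -/
def isoOfSectionE (σ : PhiGp (pfStr π hF) X →* BiratUnits (pfStr π hF) (pf_isFrobenioid π hF) X)
    (hσ : ∀ x, BiratUnits.divHom (pf_isFrobenioid π hF) X (σ x) = x) :
    Perfection (Algebra.GrothendieckGroup ((Φ π).obj (op X.obj.snd)) × D0.unitScalars (π.obj X.obj.snd)) ≃*
      BiratUnits (pfStr π hF) (pf_isFrobenioid π hF) X :=
  Perfection.prodMulEquiv.trans <|
    ((show Perfection (Algebra.GrothendieckGroup ((Φ π).obj (op X.obj.snd))) ≃* PhiGp (pfStr π hF) X from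
        gpPerfMulEquiv ((Φ π).obj (op X.obj.snd))).prodCongr e).trans <|
      (MulEquiv.prodComm (M := PhiGp (pfStr π hF) X) (N := unitsSubgroup (pfStr π hF) X)).trans
        (BiratUnits.splitProd σ hσ fun _ _ => biratUnits_mul_comm X _ _).symm

/-- `isoOfSectionE` on generators: **`iso [(z, w)] = ι(e [w]) · σ((ι_Φ)^gp z)`**. [cite: MochizukiFrdII2008, Thm 3.6 (i) p.36] -/
theorem isoOfSectionE_of (σ : PhiGp (pfStr π hF) X →* BiratUnits (pfStr π hF) (pf_isFrobenioid π hF) X)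
    (hσ : ∀ x, BiratUnits.divHom (pf_isFrobenioid π hF) X (σ x) = x)
    (z : Algebra.GrothendieckGroup ((Φ π).obj (op X.obj.snd))) (w : D0.unitScalars (π.obj X.obj.snd)) :
    isoOfSectionE X e σ hσ (Perfection.of _ (z, w)) =
      BiratUnits.unitsToBirat (pf_isFrobenioid π hF) X (e (Perfection.of _ w)) *
        σ (gpMap (Perfection.of ((Φ π).obj (op X.obj.snd))) z) := by
  unfold isoOfSectionE
  rw [MulEquiv.trans_apply, MulEquiv.trans_apply, MulEquiv.trans_apply, Perfection.prodMulEquiv_of,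
    BiratUnits.splitProd_symm_apply]
  change BiratUnits.unitsToBirat _ X (e (Perfection.of _ w)) *
      σ (gpPerfMulEquiv ((Φ π).obj (op X.obj.snd)) (Perfection.of _ z)) = _
  rw [gpPerfMulEquiv_apply, gpPerfComparison_of]

/-- A general element: `iso b = ι(e (pr₂^pf b)) · σ(interchange (pr₁^pf b))`. [cite: MochizukiFrdII2008, Thm 3.6 (i) p.36] -/
theorem isoOfSectionE_apply (σ : PhiGp (pfStr π hF) X →* BiratUnits (pfStr π hF) (pf_isFrobenioid π hF) X)
    (hσ : ∀ x, BiratUnits.divHom (pf_isFrobenioid π hF) X (σ x) = x)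
    (b : Perfection (Algebra.GrothendieckGroup ((Φ π).obj (op X.obj.snd)) × D0.unitScalars (π.obj X.obj.snd))) :
    isoOfSectionE X e σ hσ b =
      BiratUnits.unitsToBirat (pf_isFrobenioid π hF) X (e (Perfection.map (MonoidHom.snd _ _) b)) *
        σ (gpPerfComparison ((Φ π).obj (op X.obj.snd)) (Perfection.map (MonoidHom.fst _ _) b)) := by
  unfold isoOfSectionE
  rw [MulEquiv.trans_apply, MulEquiv.trans_apply, MulEquiv.trans_apply, Perfection.prodMulEquiv_apply,
    Perfection.toProd_apply_eq, BiratUnits.splitProd_symm_apply]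
  rfl

/-- **Compatibility with divisors, for every unit coordinate** (`div_iso`): `Div(iso b) = (ι^gp ∘ pr₁)^pf b`.
[cite: MochizukiFrdI2008, Prop. 4.4 (iii) p.83] -/
theorem divHom_isoOfSectionE (σ : PhiGp (pfStr π hF) X →* BiratUnits (pfStr π hF) (pf_isFrobenioid π hF) X)
    (hσ : ∀ x, BiratUnits.divHom (pf_isFrobenioid π hF) X (σ x) = x)
    (b : Perfection (Algebra.GrothendieckGroup ((Φ π).obj (op X.obj.snd)) × D0.unitScalars (π.obj X.obj.snd))) :
    BiratUnits.divHom (pf_isFrobenioid π hF) X (isoOfSectionE X e σ hσ b) =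
      gpPerfComparison ((Φ π).obj (op X.obj.snd)) (Perfection.map (MonoidHom.fst _ _) b) := by
  rw [isoOfSectionE_apply, map_mul, BiratUnits.divHom_unitsToBirat, one_mul, hσ]

/-- The same with `Div_Q = divPerfection (fieldMonoidToGp (Φ π) π)` — the `div_iso` field at
`B = (Φ^fld)^pf = perfectionFunctor (fieldMonoid (Φ π) π)`. [cite: MochizukiFrdI2008, Thm. 5.2(iv) p.101] -/
theorem divHom_isoOfSectionE_eq_divPerfection
    (σ : PhiGp (pfStr π hF) X →* BiratUnits (pfStr π hF) (pf_isFrobenioid π hF) X)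
    (hσ : ∀ x, BiratUnits.divHom (pf_isFrobenioid π hF) X (σ x) = x)
    (b : (perfectionFunctor (fieldMonoid (Φ π) π)).obj (op X.obj.snd)) :
    BiratUnits.divHom (pf_isFrobenioid π hF) X (isoOfSectionE X e σ hσ b) =
      ((divPerfection (fieldMonoidToGp (Φ π) π)).app (op X.obj.snd)).hom b :=
  divHom_isoOfSectionE X e σ hσ b

variable {X}

/-- **Naturality along a linear arrow `ψ : X → X'` of `C^pf`, reduced to generators, for unit coordinates
`e`, `e'`**: if the radial germs (`hrad`) and the `e`-unit germs (`hunit`) are intertwined along `ψ`, then so are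
`iso_X ((Φ^fld)^pf(Base ψ) b')` and `iso_{X'} b'` for every `b'` (the field `natural`).
[cite: MochizukiFrdI2008, Prop. 2.2(ii) p.45] -/
theorem intertwines_isoOfSectionE {X X' : pfCat π hF} (ψ : X ⟶ X') (hψ : IsLinear (pfStr π hF) ψ)
    (e : Perfection (D0.unitScalars (π.obj X.obj.snd)) ≃* unitsSubgroup (pfStr π hF) X)
    (e' : Perfection (D0.unitScalars (π.obj X'.obj.snd)) ≃* unitsSubgroup (pfStr π hF) X')
    (σ : PhiGp (pfStr π hF) X →* BiratUnits (pfStr π hF) (pf_isFrobenioid π hF) X)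
    (hσ : ∀ x, BiratUnits.divHom (pf_isFrobenioid π hF) X (σ x) = x)
    (σ' : PhiGp (pfStr π hF) X' →* BiratUnits (pfStr π hF) (pf_isFrobenioid π hF) X')
    (hσ' : ∀ x, BiratUnits.divHom (pf_isFrobenioid π hF) X' (σ' x) = x)
    (hrad : ∀ z : Algebra.GrothendieckGroup ((Φ π).obj (op X'.obj.snd)),
      BiratUnits.Intertwines (pf_isFrobenioid π hF) ψ
        (σ (gpMap (Perfection.of ((Φ π).obj (op X.obj.snd)))
          (gpMap ((Φ π).map (Base (pfStr π hF) ψ).op).hom z)))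
        (σ' (gpMap (Perfection.of ((Φ π).obj (op X'.obj.snd))) z)))
    (hunit : ∀ w : D0.unitScalars (π.obj X'.obj.snd),
      BiratUnits.Intertwines (pf_isFrobenioid π hF) ψ
        (BiratUnits.unitsToBirat (pf_isFrobenioid π hF) X
          (e (Perfection.of _ (D0.unitPull (π.map (Base (pfStr π hF) ψ)) w))))
        (BiratUnits.unitsToBirat (pf_isFrobenioid π hF) X' (e' (Perfection.of _ w))))
    (b' : Perfection (Algebra.GrothendieckGroup ((Φ π).obj (op X'.obj.snd)) × D0.unitScalars (π.obj X'.obj.snd))) :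
    BiratUnits.Intertwines (pf_isFrobenioid π hF) ψ
      (isoOfSectionE X e σ hσ (Perfection.map ((fieldMonoid (Φ π) π).map (Base (pfStr π hF) ψ).op).hom b'))
      (isoOfSectionE X' e' σ' hσ' b') := by
  have hsq := hasBiratSquares_of_isFrobenioid (pf_isFrobenioid π hF)
  have hiso : IsOfIsotropicType (pfStr π hF) := istrAll_Q_holds π hF (fun h => by cases h)
  have key := BiratUnits.intertwines_perfection_of_forall_of hsq hiso hψ
    (biratUnits_pow_injective X σ hσ)
    ((isoOfSectionE X e σ hσ).toMonoidHom.comp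
      (Perfection.map ((fieldMonoid (Φ π) π).map (Base (pfStr π hF) ψ).op).hom))
    (isoOfSectionE X' e' σ' hσ').toMonoidHom (fun p => ?_) b'
  · exact key
  · obtain ⟨z, w⟩ := p
    have e1 := isoOfSectionE_of X e σ hσ (gpMap ((Φ π).map (Base (pfStr π hF) ψ).op).hom z)
      (D0.unitPull (π.map (Base (pfStr π hF) ψ)) w)
    have e2 := isoOfSectionE_of X' e' σ' hσ' z w
    have key2 := BiratUnits.Intertwines.mul hsq (hunit w) (hrad z)
    rw [← e1, ← e2] at key2
    exact key2

end Thm36Sub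

end ArchFrd

end Literature.AlgebraicGeometry.Frobenioids

end
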